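import Literature.Analysis.PDE.QuasilinearTheta
import Literature.Analysis.PDE.QuasilinearFlatEstimate
import Literature.Analysis.PDE.PatchLocalization
import Literature.Analysis.PDE.LinApriori
import HarnessLib

/-!
# The Picard source of a quasilinear system in charts: data of the flat form (topic `Analysis/PDE`)

Layer (III), step 5b (wrapper), of the programme to prove short-time existence for quasilinear
strictly parabolic systems on a closed manifold (hypothesis `hQL` of
`Literature.Geometry.Riemannian.ricciFlow_shortTime_existence_of_quasilinear`). For a framed chart
`κ` and the base `u₀` this file constructs the data of the flat form
(`QuasilinearFlatEstimate.lean`) of the Picard source `Θ(v) = P(u₀ + v) - L v`: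

* `shiftDom κ 𝒪 u₀` — the shifted jet domain `{(y, J) | (κ⁻¹ y, û₀ y + J₁) ∈ 𝒪}` (open, contains
  `(y, 0)` over the target);
* `rawGc`, `rawGr` — the raw top coefficient `a(Z₀ + J) - a(Z₀)` and remainder `thetaRem` as
  functions of `(y, J)`, smooth on `shiftDom`, vanishing at `J = 0`;
* `theta_inv_eq_raw` — the chart identity
  `Θ(v)(κ⁻¹ y) = Σ rawGc (y, 𝔷 y) • D²v̂ (A bᵢ) (A bᵢ') + rawGr (y, 𝔷 y) + P(u₀)(κ⁻¹ y)`.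

Everything is proved; no named fact and no `sorry` is introduced.

## References

* C. Mantegazza, L. Martinazzi, *A note on quasilinear parabolic equations on manifolds*,
  Ann. Sc. Norm. Super. Pisa Cl. Sci. (5) 11 (2012), 857–874, §2. [MantegazzaMartinazzi2012]
-/

noncomputable section

open Set Function Filter Topology Metric InnerProductSpace
open scoped Manifold ContDiff Topology RealInnerProductSpace

namespace Literature.Analysis.PDE

open Literature.Geometry.Manifold Literature.Analysis.FunctionSpaces Literature.Analysis.FluidPDE

variable {E : Type*} [NormedAddCommGroup E] [NormedSpace ℝ E] {H : Type*} [TopologicalSpace H]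
variable {I : ModelWithCorners ℝ E H} {M : Type*} [TopologicalSpace M] [ChartedSpace H M]
variable {E' : Type*} [NormedAddCommGroup E'] [InnerProductSpace ℝ E'] [FiniteDimensional ℝ E']
variable {W : Type*} [NormedAddCommGroup W] [NormedSpace ℝ W]
variable {ι : Type*} [Fintype ι]
variable (κ : FramedChart I M E') (b : Module.Basis ι ℝ E) (𝒪 : Set (M × W))
  (a : M → E × W × (E →L[ℝ] W) → ι → ι → ℝ) (f : M → E × W × (E →L[ℝ] W) → W) (u₀ : M → W)

/-! ### The shifted jet domain and the raw data -/

/-- **The shifted jet domain** `{(y, J) | y ∈ target, (κ⁻¹ y, û₀ y + J₁) ∈ 𝒪}`.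
[cite: MantegazzaMartinazzi2012, §2] -/
def shiftDom : Set (E' × (W × (E' →L[ℝ] W))) := {q | q.1 ∈ κ.target ∧ (κ.inv q.1, (baseJet κ u₀ q.1).1 + q.2.1) ∈ 𝒪}

/-- **The raw top coefficient** `a(Z₀(y) + J) - a(Z₀(y))` (pulled back jets).
[cite: MantegazzaMartinazzi2012, §2] -/
def rawGc (i i' : ι) (q : E' × (W × (E' →L[ℝ] W))) : ℝ :=
  a κ.z (κ.jetBack q.1 ((baseJet κ u₀ q.1).1 + q.2.1) ((baseJet κ u₀ q.1).2 + q.2.2)) i i' -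
    a κ.z (κ.jetBack q.1 (baseJet κ u₀ q.1).1 (baseJet κ u₀ q.1).2) i i'

/-- **The raw remainder** `thetaRem` as a function of `(y, J)`. [cite: MantegazzaMartinazzi2012, §2] -/
def rawGr (q : E' × (W × (E' →L[ℝ] W))) : W := thetaRem κ b a f u₀ q.1 q.2

variable {κ b 𝒪 a f u₀}

omit [FiniteDimensional ℝ E'] [Fintype ι] in
/-- `rawGc` vanishes at the zero jet. [folklore] -/
@[simp] theorem rawGc_zero (i i' : ι) (y : E') : rawGc κ a u₀ i i' (y, 0) = 0 := by
  simp [rawGc]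

omit [FiniteDimensional ℝ E'] in
/-- `rawGr` vanishes at the zero jet. [folklore] -/
@[simp] theorem rawGr_zero (y : E') : rawGr κ b a f u₀ (y, 0) = 0 := by
  simp [rawGr, thetaRem_zero]

omit [FiniteDimensional ℝ E'] [Fintype ι] in
/-- Over the target the zero jet lies in the shifted domain (graph condition). [folklore] -/
theorem mem_shiftDom_zero (hg : ∀ y ∈ κ.target, (κ.inv y, u₀ (κ.inv y)) ∈ 𝒪) {y : E'} (hy : y ∈ κ.target) :
    ((y, 0) : E' × (W × (E' →L[ℝ] W))) ∈ shiftDom κ 𝒪 u₀ := by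
  refine ⟨hy, ?_⟩
  simpa [baseJet] using hg y hy

section Smooth

variable [I.Boundaryless]
  (ha : ∀ i i', ContDiffOn ℝ ∞ (fun j ↦ a κ.z j i i') {j | j.1 ∈ (extChartAt I κ.z).target ∧ ((extChartAt I κ.z).symm j.1, j.2.1) ∈ 𝒪})
  (hf : ContDiffOn ℝ ∞ (f κ.z) {j | j.1 ∈ (extChartAt I κ.z).target ∧ ((extChartAt I κ.z).symm j.1, j.2.1) ∈ 𝒪})
  (h𝒪 : IsOpen 𝒪) (huh : ContDiffOn ℝ ∞ (u₀ ∘ κ.inv) κ.target) (hg : ∀ y ∈ κ.target, (κ.inv y, u₀ (κ.inv y)) ∈ 𝒪)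

include h𝒪 huh in
omit [FiniteDimensional ℝ E'] [Fintype ι] in
/-- The shifted jet domain is open. [folklore] -/
theorem isOpen_shiftDom : IsOpen (shiftDom κ 𝒪 u₀ : Set (E' × (W × (E' →L[ℝ] W)))) := by
  have hc : ContinuousOn (fun q : E' × (W × (E' →L[ℝ] W)) ↦ (κ.inv q.1, (baseJet κ u₀ q.1).1 + q.2.1)) (κ.target ×ˢ univ) := by
    refine (κ.continuousOn_inv.comp continuousOn_fst fun q hq ↦ (mem_prod.1 hq).1).prodMk ?_
    have h1 : ContinuousOn (fun q : E' × (W × (E' →L[ℝ] W)) ↦ (baseJet κ u₀ q.1).1) (κ.target ×ˢ univ) := by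
      have h := (contDiffOn_baseJet (κ := κ) huh).continuousOn
      exact (continuous_fst.comp_continuousOn (h.comp continuousOn_fst fun q hq ↦ (mem_prod.1 hq).1))
    exact h1.add (continuous_fst.comp continuous_snd).continuousOn
  have h := hc.isOpen_inter_preimage (κ.isOpen_target.prod isOpen_univ) h𝒪
  have heq : shiftDom κ 𝒪 u₀ = κ.target ×ˢ (univ : Set (W × (E' →L[ℝ] W))) ∩
      (fun q : E' × (W × (E' →L[ℝ] W)) ↦ (κ.inv q.1, (baseJet κ u₀ q.1).1 + q.2.1)) ⁻¹' 𝒪 := by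
    ext q; simp [shiftDom, mem_prod]
  rw [heq]; exact h

include huh in
omit [FiniteDimensional ℝ E'] [Fintype ι] in
/-- The shift map `(y, J) ↦ (y, Z₀(y) + J)` is smooth over the target and maps the shifted
domain into the jet domain. [folklore] -/
theorem contDiffOn_shift : ContDiffOn ℝ ∞ (fun q : E' × (W × (E' →L[ℝ] W)) ↦ ((q.1, baseJet κ u₀ q.1 + q.2) : E' × (W × (E' →L[ℝ] W))))
    (shiftDom κ 𝒪 u₀) := by
  have hB : ContDiffOn ℝ ∞ (fun q : E' × (W × (E' →L[ℝ] W)) ↦ baseJet κ u₀ q.1) (shiftDom κ 𝒪 u₀) :=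
    (contDiffOn_baseJet (κ := κ) huh).comp contDiffOn_fst fun q hq ↦ hq.1
  exact contDiffOn_fst.prodMk (hB.add contDiffOn_snd)

omit [FiniteDimensional ℝ E'] [Fintype ι] [I.Boundaryless] in
/-- The shift map sends the shifted domain into the jet domain. [folklore] -/
theorem shift_mapsTo : MapsTo (fun q : E' × (W × (E' →L[ℝ] W)) ↦ ((q.1, baseJet κ u₀ q.1 + q.2) : E' × (W × (E' →L[ℝ] W))))
    (shiftDom κ 𝒪 u₀) (jetDom κ 𝒪) := fun q hq ↦ ⟨hq.1, by simpa using hq.2⟩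

include hg in
omit [FiniteDimensional ℝ E'] [Fintype ι] [I.Boundaryless] in
/-- The base section `(y, J) ↦ (y, Z₀(y))` sends the shifted domain into the jet domain. [folklore] -/
theorem base_mapsTo : MapsTo (fun q : E' × (W × (E' →L[ℝ] W)) ↦ ((q.1, baseJet κ u₀ q.1) : E' × (W × (E' →L[ℝ] W))))
    (shiftDom κ 𝒪 u₀) (jetDom κ 𝒪) := fun q hq ↦ ⟨hq.1, by simpa [baseJet] using hg q.1 hq.1⟩

include ha huh hg in
omit [FiniteDimensional ℝ E'] [Fintype ι] in
/-- **The raw top coefficient is smooth on the shifted domain.** [folklore] -/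
theorem contDiffOn_rawGc (i i' : ι) : ContDiffOn ℝ ∞ (rawGc κ a u₀ i i') (shiftDom κ 𝒪 u₀) := by
  have h1 := (contDiffOn_coeff_jetBack (κ := κ) (𝒪 := 𝒪) ha i i').comp (contDiffOn_shift (κ := κ) (𝒪 := 𝒪) huh) (shift_mapsTo (κ := κ))
  have hB : ContDiffOn ℝ ∞ (fun q : E' × (W × (E' →L[ℝ] W)) ↦ ((q.1, baseJet κ u₀ q.1) : E' × (W × (E' →L[ℝ] W)))) (shiftDom κ 𝒪 u₀) :=
    contDiffOn_fst.prodMk ((contDiffOn_baseJet (κ := κ) huh).comp contDiffOn_fst fun q hq ↦ hq.1)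
  have h2 := (contDiffOn_coeff_jetBack (κ := κ) (𝒪 := 𝒪) ha i i').comp hB (base_mapsTo (κ := κ) hg)
  have heq : rawGc κ a u₀ i i' = fun q ↦ (fun q : E' × (W × (E' →L[ℝ] W)) ↦ a κ.z (κ.jetBack q.1 q.2.1 q.2.2) i i') (q.1, baseJet κ u₀ q.1 + q.2) -
      (fun q : E' × (W × (E' →L[ℝ] W)) ↦ a κ.z (κ.jetBack q.1 q.2.1 q.2.2) i i') (q.1, baseJet κ u₀ q.1) := by
    funext q; simp only [rawGc, Prod.fst_add, Prod.snd_add]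
  rw [heq]
  exact h1.sub h2

include ha hf h𝒪 huh hg in
omit [FiniteDimensional ℝ E'] in
/-- **The raw remainder is smooth on the shifted domain.** [folklore] -/
theorem contDiffOn_rawGr : ContDiffOn ℝ ∞ (rawGr κ b a f u₀) (shiftDom κ 𝒪 u₀) := by
  have hN : ContDiffOn ℝ ∞ (fun q : E' × (W × (E' →L[ℝ] W)) ↦ κ.chartNonlin b a f q.1 q.2.1 q.2.2 (baseHess κ u₀ q.1)) (jetDom κ 𝒪) :=
    contDiffOn_chartNonlin ha hf (contDiffOn_baseHess huh)
  have h1 := hN.comp (contDiffOn_shift (κ := κ) (𝒪 := 𝒪) huh) (shift_mapsTo (κ := κ))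
  have hB : ContDiffOn ℝ ∞ (fun q : E' × (W × (E' →L[ℝ] W)) ↦ ((q.1, baseJet κ u₀ q.1) : E' × (W × (E' →L[ℝ] W)))) (shiftDom κ 𝒪 u₀) :=
    contDiffOn_fst.prodMk ((contDiffOn_baseJet (κ := κ) huh).comp contDiffOn_fst fun q hq ↦ hq.1)
  have h2 := hN.comp hB (base_mapsTo (κ := κ) hg)
  have h3 : ContDiffOn ℝ ∞ (fun q : E' × (W × (E' →L[ℝ] W)) ↦ linDZ κ b a f u₀ q.1 q.2) (shiftDom κ 𝒪 u₀) :=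
    ((contDiffOn_linDZ ha hf h𝒪 huh hg).comp contDiffOn_fst fun q hq ↦ hq.1).clm_apply contDiffOn_snd
  have heq : rawGr κ b a f u₀ = fun q ↦
      (fun q : E' × (W × (E' →L[ℝ] W)) ↦ κ.chartNonlin b a f q.1 q.2.1 q.2.2 (baseHess κ u₀ q.1)) (q.1, baseJet κ u₀ q.1 + q.2) -
      (fun q : E' × (W × (E' →L[ℝ] W)) ↦ κ.chartNonlin b a f q.1 q.2.1 q.2.2 (baseHess κ u₀ q.1)) (q.1, baseJet κ u₀ q.1) -
      linDZ κ b a f u₀ q.1 q.2 := by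
    funext q
    simp only [rawGr, thetaRem, nonlinBase, Prod.fst_add, Prod.snd_add]
  rw [heq]
  exact (h1.sub h2).sub h3

end Smooth

/-! ### The cut-off data: radii, smoothness, compact support -/

section Data

variable {W' : Type*} [NormedAddCommGroup W'] [InnerProductSpace ℝ W']
variable {ι' : Type*} [Fintype ι'] (PS : PatchSystem I M E' ι')

/-- **A uniform jet radius.** For `u₀` with graph in the open `𝒪` there is `ρ > 0` such that for
every patch `p`, every `y ∈ B̄(0, 4rₚ)` and every jet `‖J‖ ≤ ρ`, `(y, J)` lies in the shifted jet
domain of the chart `κₚ`. [folklore] -/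
theorem exists_jet_radius [I.Boundaryless] {𝒪 : Set (M × W')} (h𝒪 : IsOpen 𝒪) {u₀ : M → W'}
    (huh : ∀ p, ContDiffOn ℝ ∞ (u₀ ∘ (PS.chart p).inv) (PS.chart p).target) (hg : ∀ x, (x, u₀ x) ∈ 𝒪) :
    ∃ ρ : ℝ, 0 < ρ ∧ ∀ p, ∀ y ∈ closedBall (0 : E') (4 * PS.r p), ∀ J : W' × (E' →L[ℝ] W'), ‖J‖ ≤ ρ →
      (y, J) ∈ shiftDom (PS.chart p) 𝒪 u₀ := by
  have hp : ∀ p, ∃ ρ : ℝ, 0 < ρ ∧ ∀ y ∈ closedBall (0 : E') (4 * PS.r p), ∀ J : W' × (E' →L[ℝ] W'), ‖J‖ ≤ ρ →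
      (y, J) ∈ shiftDom (PS.chart p) 𝒪 u₀ := fun p ↦
    exists_radius_of_isCompact (isCompact_closedBall _ _) (isOpen_shiftDom (κ := PS.chart p) h𝒪 (huh p))
      fun y hy ↦ mem_shiftDom_zero (κ := PS.chart p) (fun y hy ↦ hg _) (PS.closedBall_subset_target p le_rfl hy)
  choose ρ hρ0 hρ using hp
  rcases isEmpty_or_nonempty ι' with hι | hι
  · exact ⟨1, one_pos, fun p ↦ (IsEmpty.false p).elim⟩
  · obtain ⟨p₀, -, hp₀⟩ := Finset.exists_min_image Finset.univ ρ Finset.univ_nonempty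
    exact ⟨ρ p₀, hρ0 p₀, fun p y hy J hJ ↦ hρ p y hy J (hJ.trans (hp₀ p (Finset.mem_univ p)))⟩

variable {PS}

/-- The support of `cutPlus_p` is `B̄(0, 4rₚ)`. [folklore] -/
theorem tsupport_cutPlus_subset_closedBall (p : ι') : tsupport (PS.cutPlus p) ⊆ closedBall (0 : E') (4 * PS.r p) := by
  rw [ContDiffBump.tsupport_eq]; rfl

omit [Fintype ι] in
/-- **Smoothness of the cut-off top coefficient.** [cite: HormanderALPDO1, Thm. 1.4.1] -/
theorem contDiff_flatGc [I.Boundaryless] [HasContDiffBump E'] (p : ι') {𝒪 : Set (M × W')} (h𝒪 : IsOpen 𝒪)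
    {a : M → E × W' × (E →L[ℝ] W') → ι → ι → ℝ} {u₀ : M → W'}
    (ha : ∀ i i', ContDiffOn ℝ ∞ (fun j ↦ a (PS.chart p).z j i i') {j | j.1 ∈ (extChartAt I (PS.chart p).z).target ∧ ((extChartAt I (PS.chart p).z).symm j.1, j.2.1) ∈ 𝒪})
    (huh : ContDiffOn ℝ ∞ (u₀ ∘ (PS.chart p).inv) (PS.chart p).target) (hg : ∀ y ∈ (PS.chart p).target, ((PS.chart p).inv y, u₀ ((PS.chart p).inv y)) ∈ 𝒪)
    {ρ ρ' : ℝ} (hρ : 0 < ρ) (hρ' : 0 < ρ') (hρρ : 2 * ((Module.finrank ℝ E' : ℝ) + 1) * ρ' ^ 2 ≤ ρ ^ 2)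
    (hKΩ : ∀ y ∈ closedBall (0 : E') (4 * PS.r p), ∀ J : W' × (E' →L[ℝ] W'), ‖J‖ ≤ ρ → (y, J) ∈ shiftDom (PS.chart p) 𝒪 u₀) (i i' : ι) :
    ContDiff ℝ ∞ (cutoffExt (PS.cutPlus p) ρ' (rawGc (PS.chart p) a u₀ i i')) :=
  contDiff_cutoffExt (PS.cutPlus p).contDiff (tsupport_cutPlus_subset_closedBall p) (isOpen_shiftDom (κ := PS.chart p) h𝒪 huh)
    (contDiffOn_rawGc ha huh hg i i') hρ hρ' hρρ hKΩ

/-- **Smoothness of the cut-off remainder.** [cite: HormanderALPDO1, Thm. 1.4.1] -/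
theorem contDiff_flatGr [I.Boundaryless] [HasContDiffBump E'] (p : ι') {𝒪 : Set (M × W')} (h𝒪 : IsOpen 𝒪)
    {a : M → E × W' × (E →L[ℝ] W') → ι → ι → ℝ} {f : M → E × W' × (E →L[ℝ] W') → W'} {u₀ : M → W'}
    (ha : ∀ i i', ContDiffOn ℝ ∞ (fun j ↦ a (PS.chart p).z j i i') {j | j.1 ∈ (extChartAt I (PS.chart p).z).target ∧ ((extChartAt I (PS.chart p).z).symm j.1, j.2.1) ∈ 𝒪})
    (hf : ContDiffOn ℝ ∞ (f (PS.chart p).z) {j | j.1 ∈ (extChartAt I (PS.chart p).z).target ∧ ((extChartAt I (PS.chart p).z).symm j.1, j.2.1) ∈ 𝒪})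
    (huh : ContDiffOn ℝ ∞ (u₀ ∘ (PS.chart p).inv) (PS.chart p).target) (hg : ∀ y ∈ (PS.chart p).target, ((PS.chart p).inv y, u₀ ((PS.chart p).inv y)) ∈ 𝒪)
    {ρ ρ' : ℝ} (hρ : 0 < ρ) (hρ' : 0 < ρ') (hρρ : 2 * ((Module.finrank ℝ E' : ℝ) + 1) * ρ' ^ 2 ≤ ρ ^ 2)
    (hKΩ : ∀ y ∈ closedBall (0 : E') (4 * PS.r p), ∀ J : W' × (E' →L[ℝ] W'), ‖J‖ ≤ ρ → (y, J) ∈ shiftDom (PS.chart p) 𝒪 u₀) :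
    ContDiff ℝ ∞ (cutoffExt (PS.cutPlus p) ρ' (rawGr (PS.chart p) b a f u₀)) :=
  contDiff_cutoffExt (PS.cutPlus p).contDiff (tsupport_cutPlus_subset_closedBall p) (isOpen_shiftDom (κ := PS.chart p) h𝒪 huh)
    (contDiffOn_rawGr ha hf h𝒪 huh hg) hρ hρ' hρρ hKΩ

/-- **Compact support of the cut-off data.** [folklore] -/
theorem hasCompactSupport_flatG [FiniteDimensional ℝ W'] (p : ι') {ρ' : ℝ} (hρ' : 0 < ρ') {V : Type*} [NormedAddCommGroup V] [NormedSpace ℝ V]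
    (G : E' × (W' × (E' →L[ℝ] W')) → V) : HasCompactSupport (cutoffExt (PS.cutPlus p) ρ' G) :=
  hasCompactSupport_cutoffExt (isCompact_closedBall _ _) (tsupport_cutPlus_subset_closedBall p) hρ' G

omit [Fintype ι] in
/-- The cut-off top coefficient vanishes at the zero jet. [folklore] -/
theorem flatGc_zero (p : ι') (ρ' : ℝ) (a : M → E × W' × (E →L[ℝ] W') → ι → ι → ℝ) (u₀ : M → W') (i i' : ι) (y : E') :
    cutoffExt (PS.cutPlus p) ρ' (rawGc (PS.chart p) a u₀ i i') (y, 0) = 0 := by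
  rw [cutoffExt_apply, rawGc_zero, smul_zero]

end Data

/-! ### The cut-off Picard source in a chart is the flat form -/

section Identity

variable {W' : Type*} [NormedAddCommGroup W'] [InnerProductSpace ℝ W']
variable {ι' : Type*} [Fintype ι'] (PS : PatchSystem I M E' ι')

/-- **The cut-off Picard source is the flat form.** For a patch `p` with chart `κ = κ_p`, data as in
`apply_sub_linOp_eq`, a radius `ρ' > 0`, and `v` whose own-chart jets are `ρ'`-small on the
support of `cut_p` (`jetQ (v̂ y, Dv̂ y) ≤ ρ'²` whenever `cut_p y ≠ 0`):
`cutExpr_p (P(u₀ + v) - L v) = Θ♭(z)` with `z = cutPlus_p • v̂`, frame vectors `A bᵢ`, coefficient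
functions the cut-off extensions of `rawGc, rawGr`, and `g₀ = cutExpr_p (P u₀)`.
[cite: MantegazzaMartinazzi2012, §3] -/
theorem cutExpr_theta_eq_thetaFlat [CompactSpace M] [I.Boundaryless] [IsManifold I ∞ M] [HasContDiffBump E'] (p : ι')
    {𝒪 : Set (M × W')} {P : (M → W') → M → W'} (h𝒪 : IsOpen 𝒪)
    {a : M → E × W' × (E →L[ℝ] W') → ι → ι → ℝ} {f : M → E × W' × (E →L[ℝ] W') → W'}
    (ha : ∀ i i', ContDiffOn ℝ ∞ (fun j ↦ a (PS.chart p).z j i i') {j | j.1 ∈ (extChartAt I (PS.chart p).z).target ∧ ((extChartAt I (PS.chart p).z).symm j.1, j.2.1) ∈ 𝒪})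
    (hf : ContDiffOn ℝ ∞ (f (PS.chart p).z) {j | j.1 ∈ (extChartAt I (PS.chart p).z).target ∧ ((extChartAt I (PS.chart p).z).symm j.1, j.2.1) ∈ 𝒪})
    (hP : ∀ u : M → W', ContMDiff I 𝓘(ℝ, W') ∞ u → (∀ x, (x, u x) ∈ 𝒪) → ∀ η ∈ (extChartAt I (PS.chart p).z).target,
      P u ((extChartAt I (PS.chart p).z).symm η) =
        (∑ i, ∑ i', a (PS.chart p).z (η, u ((extChartAt I (PS.chart p).z).symm η), fderiv ℝ (u ∘ (extChartAt I (PS.chart p).z).symm) η) i i' •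
          fderiv ℝ (fderiv ℝ (u ∘ (extChartAt I (PS.chart p).z).symm)) η (b i) (b i')) +
        f (PS.chart p).z (η, u ((extChartAt I (PS.chart p).z).symm η), fderiv ℝ (u ∘ (extChartAt I (PS.chart p).z).symm) η))
    {u₀ : M → W'} (hu₀ : ContMDiff I 𝓘(ℝ, W') ∞ u₀) (hg₀ : ∀ x, (x, u₀ x) ∈ 𝒪) {v : M → W'} (hv : ContMDiff I 𝓘(ℝ, W') ∞ v)
    (hgv : ∀ x, (x, u₀ x + v x) ∈ 𝒪) {ρ' : ℝ} (hρ' : 0 < ρ')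
    (hjet : ∀ y, PS.cut p y ≠ 0 → jetQ (jetOf (v ∘ (PS.chart p).inv) y) ≤ ρ' ^ 2) :
    PatchSystemLoc.cutExpr PS p (fun x ↦ P (fun x' ↦ u₀ x' + v x') x - linOp P u₀ v x) =
      thetaFlat (fun i ↦ (PS.chart p).A (b i)) (PS.cut p) (fun i i' ↦ cutoffExt (PS.cutPlus p) ρ' (rawGc (PS.chart p) a u₀ i i'))
        (cutoffExt (PS.cutPlus p) ρ' (rawGr (PS.chart p) b a f u₀)) (PatchSystemLoc.cutExpr PS p (P u₀))
        (fun y ↦ PS.cutPlus p y • v ((PS.chart p).inv y)) := by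
  funext y
  by_cases hc : PS.cut p y = 0
  · -- both sides vanish
    have h0 : PatchSystemLoc.cutExpr PS p (P u₀) y = 0 := by
      by_cases hy : y ∈ (PS.chart p).target
      · rw [PatchSystemLoc.cutExpr_of_mem PS _ hy, hc, zero_smul]
      · simp only [PatchSystemLoc.cutExpr, hy, if_false]
    have hL : PatchSystemLoc.cutExpr PS p (fun x ↦ P (fun x' ↦ u₀ x' + v x') x - linOp P u₀ v x) y = 0 := by
      by_cases hy : y ∈ (PS.chart p).target
      · rw [PatchSystemLoc.cutExpr_of_mem PS _ hy, hc, zero_smul]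
      · simp only [PatchSystemLoc.cutExpr, hy, if_false]
    rw [hL, thetaFlat, h0, hc, zero_smul, zero_add]
  · -- on the support of `cut_p`: `cutPlus_p = 1` nearby, so `z = v̂` near `y`
    have hyb : y ∈ ball (0 : E') (3 * PS.r p) := by
      have h : y ∈ Function.support (PS.cut p) := hc
      rwa [ContDiffBump.support_eq] at h
    have hyt : y ∈ (PS.chart p).target := PS.ball_subset_target p (by norm_num) hyb
    have hnear : (fun y ↦ PS.cutPlus p y • v ((PS.chart p).inv y)) =ᶠ[𝓝 y] (v ∘ (PS.chart p).inv) := by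
      filter_upwards [isOpen_ball.mem_nhds hyb] with y' hy'
      have h1 : PS.cutPlus p y' = 1 := ContDiffBump.one_of_mem_closedBall _ (by
        rw [PatchSystem.cutPlus_rIn]; exact ball_subset_closedBall hy')
      rw [h1, one_smul]; rfl
    have hjet0 : jetOf (fun y ↦ PS.cutPlus p y • v ((PS.chart p).inv y)) y = jetOf (v ∘ (PS.chart p).inv) y := by
      rw [jetOf_apply, jetOf_apply, hnear.fderiv_eq, hnear.eq_of_nhds]
    have hhess : fderiv ℝ (fderiv ℝ fun y ↦ PS.cutPlus p y • v ((PS.chart p).inv y)) y = fderiv ℝ (fderiv ℝ (v ∘ (PS.chart p).inv)) y := by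
      have h : fderiv ℝ (fun y ↦ PS.cutPlus p y • v ((PS.chart p).inv y)) =ᶠ[𝓝 y] fderiv ℝ (v ∘ (PS.chart p).inv) := hnear.fderiv
      exact h.fderiv_eq
    -- the cut-offs are the identity at the small jet
    have hJ : jetQ (jetOf (v ∘ (PS.chart p).inv) y) ≤ ρ' ^ 2 := hjet y hc
    have hcp : PS.cutPlus p y = 1 := ContDiffBump.one_of_mem_closedBall _ (by rw [PatchSystem.cutPlus_rIn]; exact ball_subset_closedBall hyb)
    have hGc : ∀ i i', cutoffExt (PS.cutPlus p) ρ' (rawGc (PS.chart p) a u₀ i i') (y, jetOf (v ∘ (PS.chart p).inv) y) = rawGc (PS.chart p) a u₀ i i' (y, jetOf (v ∘ (PS.chart p).inv) y) :=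
      fun i i' ↦ cutoffExt_eq hρ' hcp hJ
    have hGr : cutoffExt (PS.cutPlus p) ρ' (rawGr (PS.chart p) b a f u₀) (y, jetOf (v ∘ (PS.chart p).inv) y) = rawGr (PS.chart p) b a f u₀ (y, jetOf (v ∘ (PS.chart p).inv) y) :=
      cutoffExt_eq hρ' hcp hJ
    have hmain := apply_sub_linOp_eq (PS.chart p) b a f u₀ h𝒪 ha hf hP hu₀ hg₀ hv hgv hyt
    rw [PatchSystemLoc.cutExpr_of_mem PS _ hyt, thetaFlat, PatchSystemLoc.cutExpr_of_mem PS _ hyt, hjet0, hhess, hGr]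
    simp only [hGc]
    rw [hmain]
    simp only [rawGc, rawGr, jetOf_apply, Function.comp_apply, smul_add]

end Identity

/-! ### Chart-slab smoothness of the Picard source -/

section SlabSmooth

variable {X : Type*} [NormedAddCommGroup X] [NormedSpace ℝ X]
variable {ι' : Type*} [Fintype ι'] (PS : PatchSystem I M E' ι')

omit [FiniteDimensional ℝ E'] in
/-- **Chart-slab smoothness from cover-chart representations.** If on every inner ball
`[0, T] × B(0, 2rₚ)` the chart expression `G t (κₚ⁻¹ yy)` agrees with a function `Φₚ` smooth
there, then `G` is chart-slab-smooth in every chart. [cite: Lee2013, Thm. 2.23] -/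
theorem chartSlabSmooth_of_cover [I.Boundaryless] [IsManifold I ∞ M] {T : ℝ} {G : ℝ → M → X} (Φ : ι' → ℝ × E' → X)
    (hΦ : ∀ p, ContDiffOn ℝ ∞ (Φ p) (Icc 0 T ×ˢ ball (0 : E') (2 * PS.r p)))
    (hG : ∀ p, ∀ t ∈ Icc 0 T, ∀ yy ∈ ball (0 : E') (2 * PS.r p), G t ((PS.chart p).inv yy) = Φ p (t, yy)) (q : ι') :
    ContDiffOn ℝ ∞ (uncurry fun s y ↦ G s ((PS.chart q).inv y)) (Icc 0 T ×ˢ (PS.chart q).target) := by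
  intro z hz
  obtain ⟨t, y⟩ := z
  have ht : t ∈ Icc 0 T := (mem_prod.1 hz).1
  have hy : y ∈ (PS.chart q).target := (mem_prod.1 hz).2
  obtain ⟨p, hxp, hpx⟩ := PS.cover ((PS.chart q).inv y)
  set O : Set E' := (PS.chart q).target ∩ (PS.chart q).inv ⁻¹' ((PS.chart p).source ∩ (PS.chart p).map ⁻¹' ball (0 : E') (2 * PS.r p)) with hO
  have hOo : IsOpen O := (PS.chart q).continuousOn_inv.isOpen_inter_preimage (PS.chart q).isOpen_target
    ((PS.chart p).isOpen_source_inter_preimage isOpen_ball)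
  have hyO : y ∈ O := ⟨hy, hxp, (ball_subset_ball (by linarith [PS.r_pos p])) hpx⟩
  have hτ : ContDiffOn ℝ ∞ ((PS.chart q).transition (PS.chart p)) O :=
    ((PS.chart q).contDiffOn_transition (PS.chart p)).mono fun y' hy' ↦ ((PS.chart q).mem_overlap_iff (PS.chart p)).2 ⟨hy'.1, hy'.2.1⟩
  have hcomp : ContDiffOn ℝ ∞ (fun z : ℝ × E' ↦ Φ p (z.1, (PS.chart q).transition (PS.chart p) z.2)) (Icc 0 T ×ˢ O) := by
    refine (hΦ p).comp (contDiffOn_fst.prodMk (hτ.comp contDiffOn_snd fun z hz ↦ (mem_prod.1 hz).2)) fun z hz ↦ ?_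
    exact mk_mem_prod (mem_prod.1 hz).1 (by rw [FramedChart.transition_apply]; exact (mem_prod.1 hz).2.2.2)
  have hcongr : ∀ z ∈ Icc 0 T ×ˢ O, (uncurry fun s y ↦ G s ((PS.chart q).inv y)) z = Φ p (z.1, (PS.chart q).transition (PS.chart p) z.2) := by
    intro z hz
    obtain ⟨s, y'⟩ := z
    have hs : s ∈ Icc 0 T := (mem_prod.1 hz).1
    have hy' : y' ∈ O := (mem_prod.1 hz).2
    simp only [uncurry, FramedChart.transition_apply]
    have h := hG p s hs ((PS.chart p).map ((PS.chart q).inv y')) hy'.2.2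
    rwa [(PS.chart p).inv_map hy'.2.1] at h
  have h1 : ContDiffWithinAt ℝ ∞ (uncurry fun s y ↦ G s ((PS.chart q).inv y)) (Icc 0 T ×ˢ O) (t, y) :=
    (hcomp.congr hcongr) (t, y) (mk_mem_prod ht hyO)
  exact h1.mono_of_mem_nhdsWithin (by
    refine mem_nhdsWithin.2 ⟨univ ×ˢ O, isOpen_univ.prod hOo, mk_mem_prod (mem_univ _) hyO, ?_⟩
    rintro ⟨s, y'⟩ ⟨h1, h2⟩
    exact mk_mem_prod (mem_prod.1 h2).1 (mem_prod.1 h1).2)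

variable {W' : Type*} [NormedAddCommGroup W'] [NormedSpace ℝ W']

omit [FiniteDimensional ℝ E'] in
/-- **The chart expression of `P u` is smooth** on the target, for `P` represented in the extended
chart and `u` smooth with graph in `𝒪`. [cite: MantegazzaMartinazzi2012, §2] -/
theorem contDiffOn_apply_comp_inv [I.Boundaryless] [IsManifold I ∞ M] (κ : FramedChart I M E') {𝒪 : Set (M × W')}
    {P : (M → W') → M → W'} {a : M → E × W' × (E →L[ℝ] W') → ι → ι → ℝ} {f : M → E × W' × (E →L[ℝ] W') → W'}
    (ha : ∀ i i', ContDiffOn ℝ ∞ (fun j ↦ a κ.z j i i') {j | j.1 ∈ (extChartAt I κ.z).target ∧ ((extChartAt I κ.z).symm j.1, j.2.1) ∈ 𝒪})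
    (hf : ContDiffOn ℝ ∞ (f κ.z) {j | j.1 ∈ (extChartAt I κ.z).target ∧ ((extChartAt I κ.z).symm j.1, j.2.1) ∈ 𝒪})
    (hP : ∀ u : M → W', ContMDiff I 𝓘(ℝ, W') ∞ u → (∀ x, (x, u x) ∈ 𝒪) → ∀ η ∈ (extChartAt I κ.z).target,
      P u ((extChartAt I κ.z).symm η) =
        (∑ i, ∑ i', a κ.z (η, u ((extChartAt I κ.z).symm η), fderiv ℝ (u ∘ (extChartAt I κ.z).symm) η) i i' •
          fderiv ℝ (fderiv ℝ (u ∘ (extChartAt I κ.z).symm)) η (b i) (b i')) +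
        f κ.z (η, u ((extChartAt I κ.z).symm η), fderiv ℝ (u ∘ (extChartAt I κ.z).symm) η))
    {u : M → W'} (hu : ContMDiff I 𝓘(ℝ, W') ∞ u) (hg : ∀ x, (x, u x) ∈ 𝒪) :
    ContDiffOn ℝ ∞ (P u ∘ κ.inv) κ.target := by
  have huh : ContDiffOn ℝ ∞ (u ∘ κ.inv) κ.target := κ.contDiffOn_comp_inv hu
  have hT := κ.isOpen_target
  have hH : ContDiffOn ℝ ∞ (fun y ↦ fderiv ℝ (fderiv ℝ (u ∘ κ.inv)) y) κ.target :=
    (huh.fderiv_of_isOpen (m := ∞) hT (by norm_cast)).fderiv_of_isOpen hT (by norm_cast)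
  have hN : ContDiffOn ℝ ∞ (fun q : E' × (W' × (E' →L[ℝ] W')) ↦ κ.chartNonlin b a f q.1 q.2.1 q.2.2 (fderiv ℝ (fderiv ℝ (u ∘ κ.inv)) q.1)) (jetDom κ 𝒪) :=
    contDiffOn_chartNonlin ha hf hH
  have hJ : ContDiffOn ℝ ∞ (fun y ↦ ((y, ((u ∘ κ.inv) y, fderiv ℝ (u ∘ κ.inv) y)) : E' × (W' × (E' →L[ℝ] W')))) κ.target :=
    contDiffOn_id.prodMk (huh.prodMk (huh.fderiv_of_isOpen hT (by norm_cast)))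
  have hmaps : MapsTo (fun y ↦ ((y, ((u ∘ κ.inv) y, fderiv ℝ (u ∘ κ.inv) y)) : E' × (W' × (E' →L[ℝ] W')))) κ.target (jetDom κ 𝒪) :=
    fun y hy ↦ ⟨hy, hg _⟩
  refine (hN.comp hJ hmaps).congr fun y hy ↦ ?_
  simp only [Function.comp_apply]
  exact κ.apply_inv_eq_chartNonlin b (hP u hu hg) hT (huh.of_le (by norm_cast)) hy hy

/-- **Chart-slab smoothness of the Picard source.** For a patch system, `P` represented in the
extended charts at all patch centres, `u₀` smooth with graph in `𝒪`, and `v` chart-slab-smooth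
on `[0, T]` with `u₀ + v(s)` graph in `𝒪`, the source `Θ(v)(s) = P(u₀ + v s) - L (v s)` is
chart-slab-smooth. [cite: MantegazzaMartinazzi2012, §3] -/
theorem theta_chartSlabSmooth [CompactSpace M] [I.Boundaryless] [IsManifold I ∞ M] [HasContDiffBump E'] {T : ℝ} (hT : 0 < T)
    {𝒪 : Set (M × W')} (h𝒪 : IsOpen 𝒪) {P : (M → W') → M → W'}
    {a : M → E × W' × (E →L[ℝ] W') → ι → ι → ℝ} {f : M → E × W' × (E →L[ℝ] W') → W'}
    (ha : ∀ p i i', ContDiffOn ℝ ∞ (fun j ↦ a (PS.chart p).z j i i') {j | j.1 ∈ (extChartAt I (PS.chart p).z).target ∧ ((extChartAt I (PS.chart p).z).symm j.1, j.2.1) ∈ 𝒪})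
    (hf : ∀ p, ContDiffOn ℝ ∞ (f (PS.chart p).z) {j | j.1 ∈ (extChartAt I (PS.chart p).z).target ∧ ((extChartAt I (PS.chart p).z).symm j.1, j.2.1) ∈ 𝒪})
    (hP : ∀ p, ∀ u : M → W', ContMDiff I 𝓘(ℝ, W') ∞ u → (∀ x, (x, u x) ∈ 𝒪) → ∀ η ∈ (extChartAt I (PS.chart p).z).target,
      P u ((extChartAt I (PS.chart p).z).symm η) =
        (∑ i, ∑ i', a (PS.chart p).z (η, u ((extChartAt I (PS.chart p).z).symm η), fderiv ℝ (u ∘ (extChartAt I (PS.chart p).z).symm) η) i i' •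
          fderiv ℝ (fderiv ℝ (u ∘ (extChartAt I (PS.chart p).z).symm)) η (b i) (b i')) +
        f (PS.chart p).z (η, u ((extChartAt I (PS.chart p).z).symm η), fderiv ℝ (u ∘ (extChartAt I (PS.chart p).z).symm) η))
    {u₀ : M → W'} (hu₀ : ContMDiff I 𝓘(ℝ, W') ∞ u₀) (hg₀ : ∀ x, (x, u₀ x) ∈ 𝒪) {v : ℝ → M → W'}
    (hv : ∀ q, ContDiffOn ℝ ∞ (uncurry fun s y ↦ v s ((PS.chart q).inv y)) (Icc 0 T ×ˢ (PS.chart q).target))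
    (hvs : ∀ s ∈ Icc 0 T, ContMDiff I 𝓘(ℝ, W') ∞ (v s)) (hgv : ∀ s ∈ Icc 0 T, ∀ x, (x, u₀ x + v s x) ∈ 𝒪) (q : ι') :
    ContDiffOn ℝ ∞ (uncurry fun s y ↦ P (fun x' ↦ u₀ x' + v s x') ((PS.chart q).inv y) - linOp P u₀ (v s) ((PS.chart q).inv y))
      (Icc 0 T ×ˢ (PS.chart q).target) := by
  -- the globalised chart expressions `z_p = cutPlus_p • v̂_p`
  set z : ι' → ℝ → E' → W' := fun p t yy ↦ PS.cutPlus p yy • v t ((PS.chart p).inv yy) with hz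
  have hzs : ∀ p, IsSmoothSpaceTimeOn (Icc 0 T) (z p) := fun p ↦
    PatchSystemLoc.contDiffOn_slab_smul_of_tsupport_subset (PS.chart p).isOpen_target (PS.cutPlus p).contDiff (PS.tsupport_cutPlus_subset p) (hv p)
  have hzD : ∀ p, IsSmoothSpaceTimeOn (Icc 0 T) fun t yy ↦ fderiv ℝ (z p t) yy := fun p ↦ (hzs p).fderiv_slice (uniqueDiffOn_Icc hT)
  have hzDD : ∀ p, IsSmoothSpaceTimeOn (Icc 0 T) fun t yy ↦ fderiv ℝ (fun x ↦ fderiv ℝ (z p t) x) yy := fun p ↦ (hzD p).fderiv_slice (uniqueDiffOn_Icc hT)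
  -- near the inner balls `z_p = v̂_p`
  have hzeq : ∀ p, ∀ t, ∀ yy ∈ ball (0 : E') (3 * PS.r p), z p t =ᶠ[𝓝 yy] (v t ∘ (PS.chart p).inv) := by
    intro p t yy hyy
    filter_upwards [isOpen_ball.mem_nhds hyy] with y' hy'
    have h1 : PS.cutPlus p y' = 1 := ContDiffBump.one_of_mem_closedBall _ (by rw [PatchSystem.cutPlus_rIn]; exact ball_subset_closedBall hy')
    simp only [hz, h1, one_smul, Function.comp_apply]
  have huh : ∀ p, ContDiffOn ℝ ∞ (u₀ ∘ (PS.chart p).inv) (PS.chart p).target := fun p ↦ (PS.chart p).contDiffOn_comp_inv hu₀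
  have hgp : ∀ p, ∀ y ∈ (PS.chart p).target, ((PS.chart p).inv y, u₀ ((PS.chart p).inv y)) ∈ 𝒪 := fun p y _ ↦ hg₀ _
  -- the cover-chart representations
  set Φ : ι' → ℝ × E' → W' := fun p w ↦
    (∑ i, ∑ i', rawGc (PS.chart p) a u₀ i i' (w.2, (z p w.1 w.2, fderiv ℝ (z p w.1) w.2)) •
        fderiv ℝ (fun x ↦ fderiv ℝ (z p w.1) x) w.2 ((PS.chart p).A (b i)) ((PS.chart p).A (b i'))) +
      rawGr (PS.chart p) b a f u₀ (w.2, (z p w.1 w.2, fderiv ℝ (z p w.1) w.2)) + (P u₀ ∘ (PS.chart p).inv) w.2 with hΦ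
  refine chartSlabSmooth_of_cover PS (G := fun s x ↦ P (fun x' ↦ u₀ x' + v s x') x - linOp P u₀ (v s) x) Φ (fun p ↦ ?_) (fun p t ht yy hyy ↦ ?_) q
  · -- smoothness of `Φ p` on `[0, T] × B(0, 2rₚ)`
    have hB : Icc 0 T ×ˢ ball (0 : E') (2 * PS.r p) ⊆ Icc 0 T ×ˢ (univ : Set E') := prod_mono le_rfl (subset_univ _)
    have hz1 : ContDiffOn ℝ ∞ (fun w : ℝ × E' ↦ z p w.1 w.2) (Icc 0 T ×ˢ ball (0 : E') (2 * PS.r p)) := ContDiffOn.mono (hzs p) hB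
    have hz2 : ContDiffOn ℝ ∞ (fun w : ℝ × E' ↦ fderiv ℝ (z p w.1) w.2) (Icc 0 T ×ˢ ball (0 : E') (2 * PS.r p)) := ContDiffOn.mono (hzD p) hB
    have hJ : ContDiffOn ℝ ∞ (fun w : ℝ × E' ↦ ((w.2, (z p w.1 w.2, fderiv ℝ (z p w.1) w.2)) : E' × (W' × (E' →L[ℝ] W')))) (Icc 0 T ×ˢ ball (0 : E') (2 * PS.r p)) :=
      contDiffOn_snd.prodMk (hz1.prodMk hz2)
    have hmaps : MapsTo (fun w : ℝ × E' ↦ ((w.2, (z p w.1 w.2, fderiv ℝ (z p w.1) w.2)) : E' × (W' × (E' →L[ℝ] W'))))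
        (Icc 0 T ×ˢ ball (0 : E') (2 * PS.r p)) (shiftDom (PS.chart p) 𝒪 u₀) := by
      intro w hw
      have ht : w.1 ∈ Icc 0 T := (mem_prod.1 hw).1
      have hyy : w.2 ∈ ball (0 : E') (2 * PS.r p) := (mem_prod.1 hw).2
      have hyy3 : w.2 ∈ ball (0 : E') (3 * PS.r p) := ball_subset_ball (by linarith [PS.r_pos p]) hyy
      have hyt : w.2 ∈ (PS.chart p).target := PS.ball_subset_target p (by norm_num) hyy3
      refine ⟨hyt, ?_⟩
      have h1 : z p w.1 w.2 = v w.1 ((PS.chart p).inv w.2) := (hzeq p w.1 w.2 hyy3).eq_of_nhds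
      simp only [h1, baseJet]
      exact hgv w.1 ht _
    have h1 : ∀ i i', ContDiffOn ℝ ∞ (fun w : ℝ × E' ↦ rawGc (PS.chart p) a u₀ i i' (w.2, (z p w.1 w.2, fderiv ℝ (z p w.1) w.2))) (Icc 0 T ×ˢ ball (0 : E') (2 * PS.r p)) :=
      fun i i' ↦ (contDiffOn_rawGc (ha p) (huh p) (hgp p) i i').comp hJ hmaps
    have h2 : ContDiffOn ℝ ∞ (fun w : ℝ × E' ↦ rawGr (PS.chart p) b a f u₀ (w.2, (z p w.1 w.2, fderiv ℝ (z p w.1) w.2))) (Icc 0 T ×ˢ ball (0 : E') (2 * PS.r p)) :=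
      (contDiffOn_rawGr (ha p) (hf p) h𝒪 (huh p) (hgp p)).comp hJ hmaps
    have h3 : ∀ i i', ContDiffOn ℝ ∞ (fun w : ℝ × E' ↦ fderiv ℝ (fun x ↦ fderiv ℝ (z p w.1) x) w.2 ((PS.chart p).A (b i)) ((PS.chart p).A (b i')))
        (Icc 0 T ×ˢ ball (0 : E') (2 * PS.r p)) := by
      intro i i'
      have h : ContDiffOn ℝ ∞ (fun w : ℝ × E' ↦ fderiv ℝ (fun x ↦ fderiv ℝ (z p w.1) x) w.2) (Icc 0 T ×ˢ ball (0 : E') (2 * PS.r p)) := ContDiffOn.mono (hzDD p) hB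
      exact (h.clm_apply contDiffOn_const).clm_apply contDiffOn_const
    have h4 : ContDiffOn ℝ ∞ (fun w : ℝ × E' ↦ (P u₀ ∘ (PS.chart p).inv) w.2) (Icc 0 T ×ˢ ball (0 : E') (2 * PS.r p)) :=
      (contDiffOn_apply_comp_inv (b := b) (PS.chart p) (ha p) (hf p) (hP p) hu₀ hg₀).comp contDiffOn_snd
        fun w hw ↦ PS.ball_subset_target p (by norm_num) (mem_prod.1 hw).2
    simp only [hΦ]
    exact ((ContDiffOn.sum fun i _ ↦ ContDiffOn.sum fun i' _ ↦ (h1 i i').smul (h3 i i')).add h2).add h4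
  · -- the identity on the inner ball
    have hyy3 : yy ∈ ball (0 : E') (3 * PS.r p) := ball_subset_ball (by linarith [PS.r_pos p]) hyy
    have hyt : yy ∈ (PS.chart p).target := PS.ball_subset_target p (by norm_num) hyy3
    have hmain := apply_sub_linOp_eq (PS.chart p) b a f u₀ h𝒪 (ha p) (hf p) (hP p) hu₀ hg₀ (hvs t ht) (hgv t ht) hyt
    have hnear := hzeq p t yy hyy3
    have hz0 : z p t yy = (v t ∘ (PS.chart p).inv) yy := hnear.eq_of_nhds
    have hz1 : fderiv ℝ (z p t) yy = fderiv ℝ (v t ∘ (PS.chart p).inv) yy := hnear.fderiv_eq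
    have hz2 : fderiv ℝ (fun x ↦ fderiv ℝ (z p t) x) yy = fderiv ℝ (fderiv ℝ (v t ∘ (PS.chart p).inv)) yy := by
      have h : (fun x ↦ fderiv ℝ (z p t) x) =ᶠ[𝓝 yy] fderiv ℝ (v t ∘ (PS.chart p).inv) := hnear.fderiv
      exact h.fderiv_eq
    rw [hmain]
    simp only [hΦ, hz0, hz1, hz2, rawGc, rawGr, Function.comp_apply]

end SlabSmooth

end Literature.Analysis.PDE
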